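import Literature.NumberTheory.LFunctions.WeilFirstPrimeCertificateDataC
import HarnessLib

/-!
# First-prime Weil positivity, stage C: kernel check of the even scaled moments ν_168, ν_170, ν_172, ν_174, ν_176, ν_178

Part of `weilCert3C.check` (`WeilFirstPrimeCertificateDataC.lean`), evaluated by `decide +kernel` and kept in its own
file for kernel time and memory (each declaration is checked separately). Assembled in
`WeilFirstPrimeCertificateCCheck.lean`. Pure proof file; nothing is asserted.
-/

noncomputable section

namespace Literature.NumberTheory.LFunctions

set_option maxHeartbeats 0 in
/-- **Kernel check of the scaled moment `ν_{168}`** of the stage-C first-prime certificate. [folklore] -/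
theorem checkNuAt168_weilCert3C : weilCert3C.checkNuAt 168 = true := by
  decide +kernel

set_option maxHeartbeats 0 in
/-- **Kernel check of the scaled moment `ν_{170}`** of the stage-C first-prime certificate. [folklore] -/
theorem checkNuAt170_weilCert3C : weilCert3C.checkNuAt 170 = true := by
  decide +kernel

set_option maxHeartbeats 0 in
/-- **Kernel check of the scaled moment `ν_{172}`** of the stage-C first-prime certificate. [folklore] -/
theorem checkNuAt172_weilCert3C : weilCert3C.checkNuAt 172 = true := by
  decide +kernel

set_option maxHeartbeats 0 in
/-- **Kernel check of the scaled moment `ν_{174}`** of the stage-C first-prime certificate. [folklore] -/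
theorem checkNuAt174_weilCert3C : weilCert3C.checkNuAt 174 = true := by
  decide +kernel

set_option maxHeartbeats 0 in
/-- **Kernel check of the scaled moment `ν_{176}`** of the stage-C first-prime certificate. [folklore] -/
theorem checkNuAt176_weilCert3C : weilCert3C.checkNuAt 176 = true := by
  decide +kernel

set_option maxHeartbeats 0 in
/-- **Kernel check of the scaled moment `ν_{178}`** of the stage-C first-prime certificate. [folklore] -/
theorem checkNuAt178_weilCert3C : weilCert3C.checkNuAt 178 = true := by
  decide +kernel

end Literature.NumberTheory.LFunctions
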